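import Mathlib
import Literature.Probability.LatticeModels.LatticeGraph
import HarnessLib

/-!
# Balaban's STEP-ONE (small-field action / large-field activity) FORMAT for complex weights on the (2+1)D block torus

Defs layer requested by route BalabanIR of `HubbardSuperconductivity` (cruxes `BirComplexStableXYR` = stmt-14845 and
`BirGappedPhaseReductionR` = stmt-14846; see `Summits/…/Cruxes/BirGappedPhaseReductionR/SPLIT-PROPOSAL.md`).

Three strategist censuses (cruxes 14846 §7 F2, 2079 §7.3, 14845 SPLIT-PROPOSAL) name the same missing
object: a Lean predicate for the class of complex weights `ρ` on phase configurations of the (2+1)D block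
torus `(ℤ/L')² × ℤ/M` that (a) CAN contain the pair-phase marginal of a gapped lattice-fermion model
(infinite range, all harmonics, zeros on large-field configurations allowed) and (b) is the honest
HYPOTHESIS of a Balaban-type multiscale engine.  The typed class `BirComplexStableXYR` (finite Fourier
tables, global strip analyticity (A)) provably contains no fermion-induced weight
(`Negative.NoExactFiniteTable`, `Negative.StripZeroFree`), which is why crux 4R as typed is inert.

This module is DEFINITIONS ONLY (no theorem about Hubbard is claimed).  It types Balaban's
"small-field action / large-field activity" format AT DEPTH ONE (T. Balaban, *A low temperature
expansion for classical N-vector models I*, CMM 167 (1995) §1, (1.10)–(1.23); J. Dimock,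
arXiv:1108.1335 §2; Balaban–Feldman–Knörrer–Trubowitz, *The temporal ultraviolet limit*, Les Houches
2010, §2.1: "a dominant part which has a logarithm plus terms indexed by subsets, non-perturbatively
small, exponentially in the size of the subsets"):

* `CoerciveWeight K c₀ ρ` (W1–W4): continuity, `2π`-periodicity, U(1)/translation invariance,
  time-reflection Hermiticity (R), inversion evenness (P), `ρ 0 = 1`, and GLOBAL MODULUS COERCIVITY
  `‖ρ θ‖ ≤ exp (-c₀ K · misalign θ)` (one factor per misaligned space–time bond; for a Trotterised
  fermion trace this is Hölder in Schatten norms + free-energy phase rigidity of each slice).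
* the small-field threshold `η(K) = log K / √K` (Balaban's `p(β) β^{-1/2}`), the large-field set
  `lfSet K θ` (sites with an incident bond `cos (∂θ) ≤ cos η`), the complex small-field domains
  `sfDomain K X` (`cos (Re ∂z) > cos 2η`, `|Im ∂z| < η/8` on bonds inside `X`);
* `QuasiLocalAction K B κ A` (W5a): a family `A X : (Λ → ℂ) → ℂ` indexed by finite site sets —
  strictly `X`-local, translation covariant, U(1)-invariant, `2π`-periodic, (R), (P), vanishing at
  constants, HOLOMORPHIC on `sfDomain K X`, with the polymer budget
  `Σ_{X ∋ s} sup|A X| · e^{κ(|X|-2)} ≤ B · log² K` (the natural size of a bond term on the domain is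
  `K η² = log² K`);
* `PolymerActivity K cL κ g` (W5b): large-field ACTIVITIES `g P : (Λ → ℝ) → ℂ` — local on the
  polymer plus one collar, translation covariant, supported on connected polymers, measurable, and
  bounded by `exp (-(cL log² K) · |P ∩ LF θ| - κ · |P \ LF θ|)` (Balaban's `e^{-p(β)}` per large-field
  block, `e^{-κ}` per small-field corridor site);
* `Adm Ω Ps`: admissible polymer families for a large-field set `Ω` (pairwise non-adjacent, each
  meeting `Ω`, covering `Ω`);
* `StepOneFormat K B c₀ cL κ ρ` := `CoerciveWeight ∧ ∃ A g, QuasiLocalAction ∧ PolymerActivity ∧`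
  the REPRESENTATION `ρ θ = exp (-Σ_{X ∩ LF θ = ∅} A X θ) · Σ_{Ps ∈ Adm (LF θ)} Π_{P ∈ Ps} g P θ`
  for every real configuration `θ`.

Calibration (informal, recorded in the crux workfile SPLIT-PROPOSAL.md): the nearest-neighbour XY
Gibbs weight `exp (-K · misalign)` is in `StepOneFormat K B 1 cL κ` for `cL < 1/4`, `B ≥ 14`,
`K ≥ K₀(κ, cL)` (bond action `K(1 - cos ∂z)`, activities = products of the Gibbs factors of the bonds
touching a cluster of large-field components); every finite-range window action of
`BirComplexStableXYR`'s class with TERMWISE coercivity (C) likewise.  The two items stated over this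
predicate (engine on the class; membership ∧ transfer of the Hubbard pair-phase marginal into it) are
filed on the route, not here.  No fact is asserted in this file.
-/

noncomputable section

open scoped BigOperators ComplexConjugate Classical
open MeasureTheory Complex Filter

namespace Literature.Probability.LatticeModels.BalabanStepOne

/-- Sites of the anisotropic (2+1)D BLOCK torus: `L'` blocks per spatial side, `M` time slices. [folklore] -/
abbrev Site (L' M : ℕ) : Type := TorusSite 2 L' × ZMod M

variable {L' M : ℕ} [NeZero L'] [NeZero M]

/-- The three positive lattice directions `e₁, e₂` (space) and `e_t` (time). [folklore] -/
def dir (L' M : ℕ) (i : Fin 3) : Site L' M :=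
  if i = 0 then (![1, 0], 0) else if i = 1 then (![0, 1], 0) else (![0, 0], 1)

/-- Nearest-neighbour graph of the block torus. [folklore] -/
def adjGraph (L' M : ℕ) : SimpleGraph (Site L' M) :=
  SimpleGraph.fromRel fun s s' => ∃ i : Fin 3, s' = s + dir L' M i

/-- Time reflection through the slice `0` (the Osterwalder–Schrader reflection of the block torus). [folklore] -/
def timeRefl (s : Site L' M) : Site L' M := (s.1, -s.2)

/-- Spatial inversion through the origin. [folklore] -/
def spaceInv (s : Site L' M) : Site L' M := (-s.1, s.2)

/-- Nearest-neighbour misalignment energy `Σ_s Σ_{e} (1 - cos (θ(s+e) - θ s))`, each space–time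
bond counted once. [folklore] -/
def misalign (θ : Site L' M → ℝ) : ℝ :=
  ∑ s : Site L' M, ∑ i : Fin 3, (1 - Real.cos (θ (s + dir L' M i) - θ s))

/-- Equal-time slice order `|L'⁻² Σ_x e^{iθ(x,0)}|²` (the engine's observable; the functional of `BirComplexStableXYR`). [folklore] -/
def sliceOrder (L' M : ℕ) [NeZero L'] [NeZero M] (θ : Site L' M → ℝ) : ℝ :=
  ‖∑ x : TorusSite 2 L', cexp (I * (θ (x, (0 : ZMod M)) : ℂ))‖ ^ 2 / (L' : ℝ) ^ 4

/-- The integration cube `[0,2π]^{Λ}`. [folklore] -/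
def cube (L' M : ℕ) : Set (Site L' M → ℝ) := Set.pi Set.univ fun _ => Set.Icc (0 : ℝ) (2 * Real.pi)

/-- **W1–W4.** A complex weight `ρ` on phase configurations of the block torus that is continuous and
`2π`-periodic (W1), U(1)- and translation-invariant, time-reflection Hermitian (R) and inversion-even
(P) (W2), normalised at the aligned configuration (W3), and GLOBALLY COERCIVE IN MODULUS with rate
`c₀ K` (W4: one factor `e^{-c₀K(1-cos ∂θ)}` per misaligned space–time bond — for a Trotterised fermion trace,
Hölder in Schatten norms + free-energy phase rigidity of each slice; this is the "exponentially small factor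
per point of a large field region" that is routine for positive actions and open for complex bosonic ones,
BFKT2017 §1 p. 3). [cite: BFKT2017, §1 p. 3] -/
structure CoerciveWeight (K c₀ : ℝ) (L' M : ℕ) [NeZero L'] [NeZero M] (ρ : (Site L' M → ℝ) → ℂ) : Prop where
  cont : Continuous ρ
  periodic : ∀ (θ : Site L' M → ℝ) (s : Site L' M), ρ (Function.update θ s (θ s + 2 * Real.pi)) = ρ θ
  u1 : ∀ (θ : Site L' M → ℝ) (a : ℝ), ρ (fun s => θ s + a) = ρ θ
  transl : ∀ (θ : Site L' M → ℝ) (t : Site L' M), ρ (fun s => θ (s + t)) = ρ θ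
  reflHerm : ∀ θ : Site L' M → ℝ, ρ (fun s => θ (timeRefl s)) = conj (ρ θ)
  inversion : ∀ θ : Site L' M → ℝ, ρ (fun s => θ (spaceInv s)) = ρ θ
  norm0 : ρ (fun _ => 0) = 1
  coercive : ∀ θ : Site L' M → ℝ, ‖ρ θ‖ ≤ Real.exp (-(c₀ * K) * misalign θ)

/-- Small-field threshold `η(K) = log K / √K` (Balaban's `p(β) β^{-1/2}` with `p = log`). [cite: Balaban1995, §1] -/
def eta (K : ℝ) : ℝ := Real.log K / Real.sqrt K

/-- Large-field suppression exponent per large-field site, `p(K) = cL · log² K = cL · K η(K)²`. [cite: Balaban1995, §1] -/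
def pLF (cL K : ℝ) : ℝ := cL * Real.log K ^ 2

/-- The LARGE-FIELD SET of a real configuration: sites with an incident bond whose gradient exceeds
the threshold, `cos (∂θ) ≤ cos η(K)`. [cite: Balaban1995, §1] -/
def lfSet (K : ℝ) (θ : Site L' M → ℝ) : Finset (Site L' M) :=
  Finset.univ.filter fun s => ∃ i : Fin 3,
    Real.cos (θ (s + dir L' M i) - θ s) ≤ Real.cos (eta K) ∨
      Real.cos (θ s - θ (s - dir L' M i)) ≤ Real.cos (eta K)

/-- The complex SMALL-FIELD DOMAIN over a site set `X`: bonds inside `X` have real gradient within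
`2η(K)` of `0 (mod 2π)` and imaginary gradient below `η(K)/8` (a complex neighbourhood, of the size of the
threshold, of the real small-field configurations over `X`; the imaginary width is kept below the
large-field margin so that moduli of Gibbs factors stay controlled). [cite: Balaban1995, §1] -/
def sfDomain (K : ℝ) (X : Finset (Site L' M)) : Set (Site L' M → ℂ) :=
  {z | ∀ s ∈ X, ∀ i : Fin 3, s + dir L' M i ∈ X →
      Real.cos (2 * eta K) < Real.cos ((z (s + dir L' M i) - z s).re) ∧
        |(z (s + dir L' M i) - z s).im| < eta K / 8}

/-- **W5a — the small-field ACTION.** A family of strictly local, translation-covariant,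
U(1)-invariant, `2π`-periodic, (R)-Hermitian, (P)-even functions vanishing at constant configurations,
holomorphic on the small-field domains, with polymer budget `B · log² K` at decay rate `κ` (the natural size of
a bond term on the domain is `K η² = log² K`; single bonds carry weight `e^{0}`). [cite: Balaban1995, §1 (1.10)-(1.23)] -/
structure QuasiLocalAction (K B κ : ℝ) (L' M : ℕ) [NeZero L'] [NeZero M]
    (A : Finset (Site L' M) → (Site L' M → ℂ) → ℂ) : Prop where
  local_ : ∀ (X : Finset (Site L' M)) (z z' : Site L' M → ℂ), (∀ s ∈ X, z s = z' s) → A X z = A X z'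
  transl : ∀ (X : Finset (Site L' M)) (t : Site L' M) (z : Site L' M → ℂ),
    A (X.image (· + t)) z = A X (fun s => z (s + t))
  u1 : ∀ (X : Finset (Site L' M)) (z : Site L' M → ℂ) (c : ℂ), A X (fun s => z s + c) = A X z
  periodic : ∀ (X : Finset (Site L' M)) (z : Site L' M → ℂ) (s : Site L' M),
    A X (Function.update z s (z s + 2 * Real.pi)) = A X z
  reflHerm : ∀ (X : Finset (Site L' M)) (z : Site L' M → ℂ),
    A (X.image timeRefl) (fun s => z (timeRefl s)) = conj (A X (fun s => conj (z s)))
  inversion : ∀ (X : Finset (Site L' M)) (z : Site L' M → ℂ),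
    A (X.image spaceInv) (fun s => z (spaceInv s)) = A X z
  norm0 : ∀ (X : Finset (Site L' M)) (c : ℂ), A X (fun _ => c) = 0
  analytic : ∀ X : Finset (Site L' M), DifferentiableOn ℂ (A X) (sfDomain K X)
  budget : ∃ a : Finset (Site L' M) → ℝ,
    (∀ (X : Finset (Site L' M)), ∀ z ∈ sfDomain K X, ‖A X z‖ ≤ a X) ∧
      ∀ s₀ : Site L' M,
        ∑ X ∈ Finset.univ.filter (fun X : Finset (Site L' M) => s₀ ∈ X),
            a X * Real.exp (κ * ((X.card : ℝ) - 2)) ≤ B * Real.log K ^ 2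

/-- The one-collar neighbourhood of a site set. [folklore] -/
def collar (P : Finset (Site L' M)) : Finset (Site L' M) :=
  P ∪ P.biUnion fun s => Finset.univ.filter fun s' => (adjGraph L' M).Adj s s'

/-- Connectedness of a polymer in the nearest-neighbour graph. [folklore] -/
def IsConn (P : Finset (Site L' M)) : Prop := ((adjGraph L' M).induce (P : Set (Site L' M))).Connected

/-- **W5b — the large-field ACTIVITIES.** Polymer activities that are local on the polymer plus one
collar (the collar decides which polymer sites are large-field), translation covariant, supported on
connected polymers, measurable, and bounded by `e^{-p(K)}` per large-field site and `e^{-κ}` per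
small-field (corridor) site of the polymer ("terms indexed by subsets, non-perturbatively small, exponentially
in the size of the subsets", BalabanEtAl2010 / BFKT Les Houches 2010 §2.1). [cite: Balaban1995, §1 (1.10)-(1.23)] -/
structure PolymerActivity (K cL κ : ℝ) (L' M : ℕ) [NeZero L'] [NeZero M]
    (g : Finset (Site L' M) → (Site L' M → ℝ) → ℂ) : Prop where
  local_ : ∀ (P : Finset (Site L' M)) (θ θ' : Site L' M → ℝ),
    (∀ s ∈ collar P, θ s = θ' s) → g P θ = g P θ'
  transl : ∀ (P : Finset (Site L' M)) (t : Site L' M) (θ : Site L' M → ℝ),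
    g (P.image (· + t)) θ = g P (fun s => θ (s + t))
  conn : ∀ (P : Finset (Site L' M)) (θ : Site L' M → ℝ), ¬ IsConn P → g P θ = 0
  meas : ∀ P : Finset (Site L' M), Measurable (g P)
  bound : ∀ (P : Finset (Site L' M)) (θ : Site L' M → ℝ),
    ‖g P θ‖ ≤ Real.exp (-(pLF cL K * ((P ∩ lfSet K θ).card : ℝ) + κ * ((P \ lfSet K θ).card : ℝ)))

/-- Admissible polymer families for a large-field set `Ω`: every polymer meets `Ω`, distinct polymers
are disjoint and non-adjacent, and the family covers `Ω`.  (`Adm ∅ Ps ↔ Ps = ∅`.) [cite: KoteckyPreiss1986, §1] -/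
def Adm (Ω : Finset (Site L' M)) (Ps : Finset (Finset (Site L' M))) : Prop :=
  (∀ P ∈ Ps, (P ∩ Ω).Nonempty) ∧
    (∀ P ∈ Ps, ∀ Q ∈ Ps, P ≠ Q → ∀ s ∈ P, ∀ s' ∈ Q, s ≠ s' ∧ ¬ (adjGraph L' M).Adj s s') ∧
      Ω ⊆ Ps.biUnion id

/-- **Balaban's STEP-ONE FORMAT (depth one).** `ρ` is a coercive symmetric weight (W1–W4) which, on
every real configuration `θ` with large-field set `Ω = lfSet K θ`, FACTORISES into the Gibbs factor
of a holomorphic quasi-local small-field action over the site sets avoiding `Ω` times a hard-core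
polymer gas of large-field activities rooted in `Ω`:
`ρ θ = exp (-Σ_{X ∩ Ω = ∅} A X θ) · Σ_{Ps ∈ Adm Ω} Π_{P ∈ Ps} g P θ`.
OPEN-DESIGN OBJECT (strategist draft for the restated pair 14845′/14846′; calibration and the two-sided honesty
analysis live in `Cruxes/BirGappedPhaseReductionR/SPLIT-PROPOSAL.md`). [cite: Balaban1995, §1 (1.10)-(1.23)] -/
def StepOneFormat (K B c₀ cL κ : ℝ) (L' M : ℕ) [NeZero L'] [NeZero M] (ρ : (Site L' M → ℝ) → ℂ) : Prop :=
  CoerciveWeight K c₀ L' M ρ ∧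
    ∃ (A : Finset (Site L' M) → (Site L' M → ℂ) → ℂ) (g : Finset (Site L' M) → (Site L' M → ℝ) → ℂ),
      QuasiLocalAction K B κ L' M A ∧ PolymerActivity K cL κ L' M g ∧
        ∀ θ : Site L' M → ℝ,
          ρ θ =
            cexp (-(∑ X ∈ Finset.univ.filter (fun X : Finset (Site L' M) => Disjoint X (lfSet K θ)),
                      A X (fun s => (θ s : ℂ)))) *
              ∑ Ps ∈ Finset.univ.filter (fun Ps : Finset (Finset (Site L' M)) => Adm (lfSet K θ) Ps),
                ∏ P ∈ Ps, g P θ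

/-- The engine's conclusion for a weight: non-vanishing partition function and slice order `≥ 1/2` (the conclusion of
`BirComplexStableXYR`, stated for a weight instead of a table). [folklore] -/
def EngineConclusion (L' M : ℕ) [NeZero L'] [NeZero M] (ρ : (Site L' M → ℝ) → ℂ) : Prop :=
  (∫ θ in cube L' M, ρ θ) ≠ 0 ∧
    (1 / 2 : ℝ) ≤ ((∫ θ in cube L' M, (sliceOrder L' M θ : ℂ) * ρ θ) / ∫ θ in cube L' M, ρ θ).re

end Literature.Probability.LatticeModels.BalabanStepOne

end
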